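import Mathlib
import HarnessLib

/-!
# Stub `stub_atomReduction`, tools III: cubical atoms

Registered sub-goal of this file: `stub_atomReduction_diagShift`.

The integrands of the line `torus-descent-sum-shadow` on the open cube `(0,1)ᵏ`:
`ATOM⟪k, a, e, x⟫ = ∏ᵢ xᵢ^{aᵢ} · ∏_{i ≤ j} (1 - xᵢ ⋯ xⱼ)^{e i j}` (`a ∈ ℕᵏ`, `e ∈ ℤ`), in the exact
shape registered in the skeleton. Contents: positivity of the chords `1 - xᵢ⋯xⱼ` on the open cube;
`zpow_two_sided`; closure lemmas (`isMono_*`, `isChordal_*`) for "is a Laurent monomial on the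
cube" and "is a product of integer powers of chords on the cube", used to put the pulled-back
genus-zero integrand in atom shape without explicit exponent bookkeeping; `atomFun_add_diag` —
multiplying an atom kernel by `∏ (1 - xᵢ)^{νᵢ}` shifts the diagonal exponents.

Recurring terms are written through parse-time notations (`CP⟪⟫`, `ATOM⟪⟫`, `SEC⟪⟫`, `NC⟪⟫`,
`CHORD⟪⟫`, `WEIGHT⟪⟫`, `EXPL⟪⟫`, `CPOLY⟪⟫`, `DIAG⟪⟫`, …); the files introduce no definitions.
-/

noncomputable section

open MeasureTheory Set MvPolynomial Filter Topology

namespace Summit.KontsevichZagierPeriods.DihedralNormalForm.TorusDescent.AtomReduction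

/-! ### Notation (parse-time abbreviations; no definitions are introduced) -/

set_option quotPrecheck false

local notation "CP⟪" k ", " i ", " j ", " x "⟫" =>
  (∏ l : Fin k, if i ≤ l ∧ l ≤ j then x l else (1:ℝ))
local notation "ATOM⟪" k ", " a ", " e ", " x "⟫" =>
  ((∏ i : Fin k, x i ^ (a i : ℕ)) *
    ∏ i : Fin k, ∏ j : Fin k, if i ≤ j then (1 - CP⟪k, i, j, x⟫) ^ (e i j : ℤ) else (1:ℝ))
local notation "DIAG⟪" ν "⟫" => (fun i j => if i = j then ((ν i : ℕ) : ℤ) else 0)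

set_option quotPrecheck true

variable {k : ℕ}

/-! ### Chord products and atom kernels -/

/-- A chord product on the open cube is positive. -/
theorem cp_pos (i j : Fin k) {x : Fin k → ℝ} (hx : ∀ i, x i ∈ Ioo (0:ℝ) 1) : 0 < CP⟪k, i, j, x⟫ :=
  Finset.prod_pos fun l _ => by
    split_ifs
    · exact (hx l).1
    · exact one_pos

/-- A chord product on the open cube is at most `1`. -/
theorem cp_le_one (i j : Fin k) {x : Fin k → ℝ} (hx : ∀ i, x i ∈ Ioo (0:ℝ) 1) : CP⟪k, i, j, x⟫ ≤ 1 :=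
  Finset.prod_le_one (fun l _ => by split_ifs; exacts [(hx l).1.le, zero_le_one]) fun l _ => by
    split_ifs; exacts [(hx l).2.le, le_rfl]

/-- A non-empty chord product on the open cube is `< 1`. -/
theorem cp_lt_one {i j : Fin k} (hij : i ≤ j) {x : Fin k → ℝ} (hx : ∀ i, x i ∈ Ioo (0:ℝ) 1) :
    CP⟪k, i, j, x⟫ < 1 := by
  rw [← Finset.mul_prod_erase Finset.univ _ (Finset.mem_univ i), if_pos ⟨le_rfl, hij⟩]
  have h1 : ∏ l ∈ Finset.univ.erase i, (if i ≤ l ∧ l ≤ j then x l else 1) ≤ 1 :=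
    Finset.prod_le_one (fun l _ => by split_ifs; exacts [(hx l).1.le, zero_le_one]) fun l _ => by
      split_ifs; exacts [(hx l).2.le, le_rfl]
  have h0 : 0 ≤ ∏ l ∈ Finset.univ.erase i, (if i ≤ l ∧ l ≤ j then x l else 1) :=
    Finset.prod_nonneg fun l _ => by split_ifs; exacts [(hx l).1.le, zero_le_one]
  calc x i * ∏ l ∈ Finset.univ.erase i, (if i ≤ l ∧ l ≤ j then x l else 1) ≤ x i * 1 :=
        mul_le_mul_of_nonneg_left h1 (hx i).1.le
    _ < 1 := by rw [mul_one]; exact (hx i).2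

/-- A non-empty chord product is at most its first coordinate. -/
theorem cp_le_apply {i j : Fin k} (hij : i ≤ j) {x : Fin k → ℝ} (hx : ∀ i, x i ∈ Ioo (0:ℝ) 1) :
    CP⟪k, i, j, x⟫ ≤ x i := by
  rw [← Finset.mul_prod_erase Finset.univ _ (Finset.mem_univ i), if_pos ⟨le_rfl, hij⟩]
  have h1 : ∏ l ∈ Finset.univ.erase i, (if i ≤ l ∧ l ≤ j then x l else 1) ≤ 1 :=
    Finset.prod_le_one (fun l _ => by split_ifs; exacts [(hx l).1.le, zero_le_one]) fun l _ => by
      split_ifs; exacts [(hx l).2.le, le_rfl]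
  calc x i * ∏ l ∈ Finset.univ.erase i, (if i ≤ l ∧ l ≤ j then x l else 1) ≤ x i * 1 :=
        mul_le_mul_of_nonneg_left h1 (hx i).1.le
    _ = x i := mul_one _

/-- The chords `1 - xᵢ⋯xⱼ` (`i ≤ j`) are positive on the open cube. -/
theorem one_sub_cp_pos {i j : Fin k} (hij : i ≤ j) {x : Fin k → ℝ} (hx : ∀ i, x i ∈ Ioo (0:ℝ) 1) :
    0 < 1 - CP⟪k, i, j, x⟫ := by
  linarith [cp_lt_one hij hx]

/-- The diagonal chord product is the coordinate: `cp i i x = xᵢ`. -/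
theorem cp_self (i : Fin k) (x : Fin k → ℝ) : CP⟪k, i, i, x⟫ = x i := by
  have : ∀ l : Fin k, (i ≤ l ∧ l ≤ i) ↔ i = l := fun l =>
    ⟨fun h => le_antisymm h.1 h.2, fun h => h ▸ ⟨le_rfl, le_rfl⟩⟩
  simp_rw [this]
  exact Finset.prod_ite_eq Finset.univ i x |>.trans (if_pos (Finset.mem_univ i))

/-- The atom kernel is non-negative on the open cube. -/
theorem atomFun_nonneg (a : Fin k → ℕ) (e : Fin k → Fin k → ℤ) {x : Fin k → ℝ}
    (hx : ∀ i, x i ∈ Ioo (0:ℝ) 1) : 0 ≤ ATOM⟪k, a, e, x⟫ := by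
  refine mul_nonneg (Finset.prod_nonneg fun i _ => pow_nonneg (hx i).1.le _)
    (Finset.prod_nonneg fun i _ => Finset.prod_nonneg fun j _ => ?_)
  split_ifs with h
  · exact (zpow_pos (one_sub_cp_pos h hx) _).le
  · exact zero_le_one

/-- Two-sided comparison of integer powers of comparable positive bases. -/
theorem zpow_two_sided {a b c : ℝ} (ha : 0 < a) (hab : a ≤ b) (hbc : b ≤ c * a) (hc : 1 ≤ c)
    (γ : ℤ) : (c ^ γ.natAbs)⁻¹ * a ^ γ ≤ b ^ γ ∧ b ^ γ ≤ c ^ γ.natAbs * a ^ γ := by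
  have hb : 0 < b := ha.trans_le hab
  have hcm : (1:ℝ) ≤ c ^ γ.natAbs := one_le_pow₀ hc
  have hbm : b ^ γ.natAbs ≤ c ^ γ.natAbs * a ^ γ.natAbs := by
    rw [← mul_pow]; exact pow_le_pow_left₀ hb.le hbc _
  have ham : a ^ γ.natAbs ≤ b ^ γ.natAbs := pow_le_pow_left₀ ha.le hab _
  rcases Int.natAbs_eq γ with hγ | hγ
  · rw [hγ]
    simp only [zpow_natCast, Int.natAbs_natCast]
    constructor
    · calc (c ^ γ.natAbs)⁻¹ * a ^ γ.natAbs ≤ 1 * a ^ γ.natAbs :=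
            mul_le_mul_of_nonneg_right (inv_le_one_of_one_le₀ hcm) (pow_nonneg ha.le _)
        _ ≤ b ^ γ.natAbs := by rw [one_mul]; exact ham
    · exact hbm
  · rw [hγ]
    simp only [zpow_neg, zpow_natCast, Int.natAbs_neg, Int.natAbs_natCast]
    constructor
    · rw [← mul_inv]
      exact inv_anti₀ (pow_pos hb _) hbm
    · calc (b ^ γ.natAbs)⁻¹ ≤ (a ^ γ.natAbs)⁻¹ := inv_anti₀ (pow_pos ha _) ham
        _ ≤ c ^ γ.natAbs * (a ^ γ.natAbs)⁻¹ :=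
            le_mul_of_one_le_left (inv_nonneg.2 (pow_nonneg ha.le _)) hcm


/-! ### Laurent monomials and chord products on the cube: closure lemmas

"`f` is a Laurent monomial on the open cube" is the statement
`∃ d : Fin k → ℤ, ∀ x, (∀ i, x i ∈ Ioo 0 1) → f x = ∏ l, x l ^ d l`; "`f` is chordal" is
`∃ e : Fin k → Fin k → ℤ, ∀ x, (∀ i, x i ∈ Ioo 0 1) → f x = ∏ i, ∏ j, if i ≤ j then (1 - CP⟪k, i, j, x⟫) ^ e i j else 1`.
Both classes are closed under products, inverses and natural powers. -/

section Mono

/-- The constant `1` is a monomial on the cube. -/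
theorem isMono_one : ∃ d : Fin k → ℤ, ∀ x : Fin k → ℝ, (∀ i, x i ∈ Ioo (0:ℝ) 1) →
    (1:ℝ) = ∏ l, x l ^ d l :=
  ⟨0, fun x _ => by simp⟩

/-- A coordinate is a monomial on the cube. -/
theorem isMono_apply (l : Fin k) : ∃ d : Fin k → ℤ, ∀ x : Fin k → ℝ, (∀ i, x i ∈ Ioo (0:ℝ) 1) →
    x l = ∏ l', x l' ^ d l' := by
  classical
  refine ⟨fun l' => if l' = l then 1 else 0, fun x _ => ?_⟩
  rw [Finset.prod_eq_single l]
  · simp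
  · intro l' _ hl'
    simp [hl']
  · intro h; exact absurd (Finset.mem_univ l) h

/-- A monomial with natural exponents is a monomial on the cube. -/
theorem isMono_prod_pow (a : Fin k → ℕ) : ∃ d : Fin k → ℤ, ∀ x : Fin k → ℝ,
    (∀ i, x i ∈ Ioo (0:ℝ) 1) → (∏ l, x l ^ a l) = ∏ l, x l ^ d l :=
  ⟨fun l => (a l : ℤ), fun _ _ => Finset.prod_congr rfl fun _ _ => (zpow_natCast _ _).symm⟩

/-- Products of monomials are monomials. -/
theorem isMono_mul {f g : (Fin k → ℝ) → ℝ}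
    (hf : ∃ d : Fin k → ℤ, ∀ x : Fin k → ℝ, (∀ i, x i ∈ Ioo (0:ℝ) 1) → f x = ∏ l, x l ^ d l)
    (hg : ∃ d : Fin k → ℤ, ∀ x : Fin k → ℝ, (∀ i, x i ∈ Ioo (0:ℝ) 1) → g x = ∏ l, x l ^ d l) :
    ∃ d : Fin k → ℤ, ∀ x : Fin k → ℝ, (∀ i, x i ∈ Ioo (0:ℝ) 1) → f x * g x = ∏ l, x l ^ d l := by
  obtain ⟨d₁, h₁⟩ := hf
  obtain ⟨d₂, h₂⟩ := hg
  refine ⟨d₁ + d₂, fun x hx => ?_⟩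
  rw [h₁ x hx, h₂ x hx, ← Finset.prod_mul_distrib]
  exact Finset.prod_congr rfl fun l _ => (zpow_add₀ (hx l).1.ne' _ _).symm

/-- Inverses of monomials are monomials. -/
theorem isMono_inv {f : (Fin k → ℝ) → ℝ}
    (hf : ∃ d : Fin k → ℤ, ∀ x : Fin k → ℝ, (∀ i, x i ∈ Ioo (0:ℝ) 1) → f x = ∏ l, x l ^ d l) :
    ∃ d : Fin k → ℤ, ∀ x : Fin k → ℝ, (∀ i, x i ∈ Ioo (0:ℝ) 1) → (f x)⁻¹ = ∏ l, x l ^ d l := by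
  obtain ⟨d, h⟩ := hf
  refine ⟨-d, fun x hx => ?_⟩
  rw [h x hx, ← Finset.prod_inv_distrib]
  exact Finset.prod_congr rfl fun l _ => by rw [Pi.neg_apply, zpow_neg]

/-- Natural powers of monomials are monomials. -/
theorem isMono_pow {f : (Fin k → ℝ) → ℝ}
    (hf : ∃ d : Fin k → ℤ, ∀ x : Fin k → ℝ, (∀ i, x i ∈ Ioo (0:ℝ) 1) → f x = ∏ l, x l ^ d l)
    (n : ℕ) :
    ∃ d : Fin k → ℤ, ∀ x : Fin k → ℝ, (∀ i, x i ∈ Ioo (0:ℝ) 1) → f x ^ n = ∏ l, x l ^ d l := by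
  obtain ⟨d, h⟩ := hf
  refine ⟨fun l => d l * n, fun x hx => ?_⟩
  rw [h x hx, ← Finset.prod_pow]
  exact Finset.prod_congr rfl fun l _ => by rw [← zpow_natCast, ← zpow_mul]

/-- Finite products of monomials are monomials. -/
theorem isMono_finset_prod {ι : Type*} (s : Finset ι) {f : ι → (Fin k → ℝ) → ℝ}
    (h : ∀ a ∈ s, ∃ d : Fin k → ℤ, ∀ x : Fin k → ℝ, (∀ i, x i ∈ Ioo (0:ℝ) 1) →
      f a x = ∏ l, x l ^ d l) :
    ∃ d : Fin k → ℤ, ∀ x : Fin k → ℝ, (∀ i, x i ∈ Ioo (0:ℝ) 1) →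
      (∏ a ∈ s, f a x) = ∏ l, x l ^ d l := by
  classical
  induction s using Finset.induction_on with
  | empty => simpa using (isMono_one (k := k))
  | insert a s ha ih =>
    obtain ⟨d, hd⟩ := isMono_mul (h a (Finset.mem_insert_self a s))
      (ih fun b hb => h b (Finset.mem_insert_of_mem hb))
    exact ⟨d, fun x hx => by rw [Finset.prod_insert ha]; exact hd x hx⟩

/-- Case distinctions (not depending on the point) of monomials are monomials. -/
theorem isMono_ite (c : Prop) [Decidable c] {f g : (Fin k → ℝ) → ℝ}
    (hf : ∃ d : Fin k → ℤ, ∀ x : Fin k → ℝ, (∀ i, x i ∈ Ioo (0:ℝ) 1) → f x = ∏ l, x l ^ d l)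
    (hg : ∃ d : Fin k → ℤ, ∀ x : Fin k → ℝ, (∀ i, x i ∈ Ioo (0:ℝ) 1) → g x = ∏ l, x l ^ d l) :
    ∃ d : Fin k → ℤ, ∀ x : Fin k → ℝ, (∀ i, x i ∈ Ioo (0:ℝ) 1) →
      (if c then f x else g x) = ∏ l, x l ^ d l := by
  by_cases hc : c
  · simp only [hc, if_true]; exact hf
  · simp only [hc, if_false]; exact hg

/-- The partial products `x₀ ⋯ xᵢ` of the cubical chart are monomials. -/
theorem isMono_pprod (i : Fin k) : ∃ d : Fin k → ℤ, ∀ x : Fin k → ℝ, (∀ i, x i ∈ Ioo (0:ℝ) 1) →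
    (∏ j ∈ Finset.univ.filter (fun j => j ≤ i), x j) = ∏ l, x l ^ d l :=
  isMono_finset_prod _ fun j _ => isMono_apply j

end Mono

section Chordal

/-- The constant `1` is chordal. -/
theorem isChordal_one : ∃ e : Fin k → Fin k → ℤ, ∀ x : Fin k → ℝ, (∀ i, x i ∈ Ioo (0:ℝ) 1) →
    (1:ℝ) = ∏ i, ∏ j, if i ≤ j then (1 - CP⟪k, i, j, x⟫) ^ e i j else 1 :=
  ⟨0, fun x _ => by simp⟩

/-- A chord `1 - xᵢ⋯xⱼ` (`i ≤ j`) is chordal. -/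
theorem isChordal_chord {i j : Fin k} (hij : i ≤ j) :
    ∃ e : Fin k → Fin k → ℤ, ∀ x : Fin k → ℝ, (∀ i, x i ∈ Ioo (0:ℝ) 1) →
      (1 - CP⟪k, i, j, x⟫) = ∏ i', ∏ j', if i' ≤ j' then (1 - CP⟪k, i', j', x⟫) ^ e i' j' else 1 := by
  classical
  refine ⟨fun i' j' => if i' = i ∧ j' = j then 1 else 0, fun x _ => ?_⟩
  symm
  rw [Finset.prod_eq_single i, Finset.prod_eq_single j]
  · simp [hij]
  · intro j' _ hj'
    simp [hj']
  · intro h; exact absurd (Finset.mem_univ j) h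
  · intro i' _ hi'
    refine Finset.prod_eq_one fun j' _ => ?_
    simp [hi']
  · intro h; exact absurd (Finset.mem_univ i) h

/-- Products of chordal functions are chordal. -/
theorem isChordal_mul {f g : (Fin k → ℝ) → ℝ}
    (hf : ∃ e : Fin k → Fin k → ℤ, ∀ x : Fin k → ℝ, (∀ i, x i ∈ Ioo (0:ℝ) 1) →
      f x = ∏ i, ∏ j, if i ≤ j then (1 - CP⟪k, i, j, x⟫) ^ e i j else 1)
    (hg : ∃ e : Fin k → Fin k → ℤ, ∀ x : Fin k → ℝ, (∀ i, x i ∈ Ioo (0:ℝ) 1) →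
      g x = ∏ i, ∏ j, if i ≤ j then (1 - CP⟪k, i, j, x⟫) ^ e i j else 1) :
    ∃ e : Fin k → Fin k → ℤ, ∀ x : Fin k → ℝ, (∀ i, x i ∈ Ioo (0:ℝ) 1) →
      f x * g x = ∏ i, ∏ j, if i ≤ j then (1 - CP⟪k, i, j, x⟫) ^ e i j else 1 := by
  obtain ⟨e₁, h₁⟩ := hf
  obtain ⟨e₂, h₂⟩ := hg
  refine ⟨e₁ + e₂, fun x hx => ?_⟩
  rw [h₁ x hx, h₂ x hx, ← Finset.prod_mul_distrib]
  refine Finset.prod_congr rfl fun i _ => ?_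
  rw [← Finset.prod_mul_distrib]
  refine Finset.prod_congr rfl fun j _ => ?_
  split_ifs with h
  · rw [Pi.add_apply, Pi.add_apply, zpow_add₀ (one_sub_cp_pos h hx).ne']
  · rw [mul_one]

/-- Inverses of chordal functions are chordal. -/
theorem isChordal_inv {f : (Fin k → ℝ) → ℝ}
    (hf : ∃ e : Fin k → Fin k → ℤ, ∀ x : Fin k → ℝ, (∀ i, x i ∈ Ioo (0:ℝ) 1) →
      f x = ∏ i, ∏ j, if i ≤ j then (1 - CP⟪k, i, j, x⟫) ^ e i j else 1) :
    ∃ e : Fin k → Fin k → ℤ, ∀ x : Fin k → ℝ, (∀ i, x i ∈ Ioo (0:ℝ) 1) →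
      (f x)⁻¹ = ∏ i, ∏ j, if i ≤ j then (1 - CP⟪k, i, j, x⟫) ^ e i j else 1 := by
  obtain ⟨e, h⟩ := hf
  refine ⟨-e, fun x hx => ?_⟩
  rw [h x hx, ← Finset.prod_inv_distrib]
  refine Finset.prod_congr rfl fun i _ => ?_
  rw [← Finset.prod_inv_distrib]
  refine Finset.prod_congr rfl fun j _ => ?_
  split_ifs
  · rw [Pi.neg_apply, Pi.neg_apply, zpow_neg]
  · rw [inv_one]

/-- Natural powers of chordal functions are chordal. -/
theorem isChordal_pow {f : (Fin k → ℝ) → ℝ}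
    (hf : ∃ e : Fin k → Fin k → ℤ, ∀ x : Fin k → ℝ, (∀ i, x i ∈ Ioo (0:ℝ) 1) →
      f x = ∏ i, ∏ j, if i ≤ j then (1 - CP⟪k, i, j, x⟫) ^ e i j else 1) (n : ℕ) :
    ∃ e : Fin k → Fin k → ℤ, ∀ x : Fin k → ℝ, (∀ i, x i ∈ Ioo (0:ℝ) 1) →
      f x ^ n = ∏ i, ∏ j, if i ≤ j then (1 - CP⟪k, i, j, x⟫) ^ e i j else 1 := by
  obtain ⟨e, h⟩ := hf
  refine ⟨fun i j => e i j * n, fun x hx => ?_⟩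
  rw [h x hx, ← Finset.prod_pow]
  refine Finset.prod_congr rfl fun i _ => ?_
  rw [← Finset.prod_pow]
  refine Finset.prod_congr rfl fun j _ => ?_
  split_ifs
  · rw [← zpow_natCast, ← zpow_mul]
  · rw [one_pow]

/-- Finite products of chordal functions are chordal. -/
theorem isChordal_finset_prod {ι : Type*} (s : Finset ι) {f : ι → (Fin k → ℝ) → ℝ}
    (h : ∀ a ∈ s, ∃ e : Fin k → Fin k → ℤ, ∀ x : Fin k → ℝ, (∀ i, x i ∈ Ioo (0:ℝ) 1) →
      f a x = ∏ i, ∏ j, if i ≤ j then (1 - CP⟪k, i, j, x⟫) ^ e i j else 1) :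
    ∃ e : Fin k → Fin k → ℤ, ∀ x : Fin k → ℝ, (∀ i, x i ∈ Ioo (0:ℝ) 1) →
      (∏ a ∈ s, f a x) = ∏ i, ∏ j, if i ≤ j then (1 - CP⟪k, i, j, x⟫) ^ e i j else 1 := by
  classical
  induction s using Finset.induction_on with
  | empty => simpa using (isChordal_one (k := k))
  | insert a s ha ih =>
    obtain ⟨e, he⟩ := isChordal_mul (h a (Finset.mem_insert_self a s))
      (ih fun b hb => h b (Finset.mem_insert_of_mem hb))
    exact ⟨e, fun x hx => by rw [Finset.prod_insert ha]; exact he x hx⟩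

/-- Case distinctions (not depending on the point) of chordal functions are chordal. -/
theorem isChordal_ite (c : Prop) [Decidable c] {f g : (Fin k → ℝ) → ℝ}
    (hf : ∃ e : Fin k → Fin k → ℤ, ∀ x : Fin k → ℝ, (∀ i, x i ∈ Ioo (0:ℝ) 1) →
      f x = ∏ i, ∏ j, if i ≤ j then (1 - CP⟪k, i, j, x⟫) ^ e i j else 1)
    (hg : ∃ e : Fin k → Fin k → ℤ, ∀ x : Fin k → ℝ, (∀ i, x i ∈ Ioo (0:ℝ) 1) →
      g x = ∏ i, ∏ j, if i ≤ j then (1 - CP⟪k, i, j, x⟫) ^ e i j else 1) :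
    ∃ e : Fin k → Fin k → ℤ, ∀ x : Fin k → ℝ, (∀ i, x i ∈ Ioo (0:ℝ) 1) →
      (if c then f x else g x) = ∏ i, ∏ j, if i ≤ j then (1 - CP⟪k, i, j, x⟫) ^ e i j else 1 := by
  by_cases hc : c
  · simp only [hc, if_true]; exact hf
  · simp only [hc, if_false]; exact hg

end Chordal

/-- **Atom shape**: `(ℕ-monomial) · (chordal) = atomFun`. -/
theorem exists_atomFun_of_isChordal {K : (Fin k → ℝ) → ℝ}
    (hK : ∃ e : Fin k → Fin k → ℤ, ∀ x : Fin k → ℝ, (∀ i, x i ∈ Ioo (0:ℝ) 1) →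
      K x = ∏ i, ∏ j, if i ≤ j then (1 - CP⟪k, i, j, x⟫) ^ e i j else 1) (a : Fin k → ℕ) :
    ∃ e : Fin k → Fin k → ℤ, ∀ x : Fin k → ℝ, (∀ i, x i ∈ Ioo (0:ℝ) 1) →
      (∏ l, x l ^ a l) * K x = ATOM⟪k, a, e, x⟫ := by
  obtain ⟨e, he⟩ := hK
  exact ⟨e, fun x hx => by rw [he x hx]⟩

/-! ### Diagonal shifts -/

/-- Multiplying an atom kernel by `∏ (1 - xᵢ)^{νᵢ}` shifts the diagonal exponents. -/
theorem atomFun_add_diag (a : Fin k → ℕ) (e : Fin k → Fin k → ℤ) (ν : Fin k →₀ ℕ)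
    {x : Fin k → ℝ} (hx : ∀ i, x i ∈ Ioo (0:ℝ) 1) :
    ATOM⟪k, a, (e + DIAG⟪ν⟫), x⟫ = (∏ i, (1 - x i) ^ ν i) * ATOM⟪k, a, e, x⟫ := by
  classical
  have hsplit : (∏ i, ∏ j, if i ≤ j then (1 - CP⟪k, i, j, x⟫) ^ (e + DIAG⟪ν⟫) i j else (1:ℝ)) =
      (∏ i, ∏ j, if i ≤ j then (1 - CP⟪k, i, j, x⟫) ^ e i j else (1:ℝ)) *
        ∏ i, ∏ j, if i ≤ j then (1 - CP⟪k, i, j, x⟫) ^ DIAG⟪ν⟫ i j else (1:ℝ) := by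
    rw [← Finset.prod_mul_distrib]
    refine Finset.prod_congr rfl fun i _ => ?_
    rw [← Finset.prod_mul_distrib]
    refine Finset.prod_congr rfl fun j _ => ?_
    split_ifs with h
    · rw [Pi.add_apply, Pi.add_apply, zpow_add₀ (one_sub_cp_pos h hx).ne']
    · rw [mul_one]
  have hdiag : (∏ i, ∏ j, if i ≤ j then (1 - CP⟪k, i, j, x⟫) ^ DIAG⟪ν⟫ i j else (1:ℝ)) =
      ∏ i, (1 - x i) ^ ν i := by
    refine Finset.prod_congr rfl fun i _ => ?_
    rw [Finset.prod_eq_single i]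
    · rw [if_pos le_rfl, cp_self]
      beta_reduce
      rw [if_pos rfl, zpow_natCast]
    · intro j _ hj
      beta_reduce
      rw [if_neg (Ne.symm hj)]
      split_ifs <;> simp
    · intro h; exact absurd (Finset.mem_univ i) h
  rw [hsplit, hdiag]
  ring

/-- **Registered sub-goal `stub_atomReduction_diagShift`** (tools III): multiplying an atom kernel by
`∏ (1 - xᵢ)^{νᵢ}` shifts the diagonal exponents. -/
theorem stub_atomReduction_diagShift : ∀ (k : ℕ) (a : Fin k → ℕ) (e : Fin k → Fin k → ℤ) (ν : Fin k →₀ ℕ) (x : Fin k → ℝ), (∀ i, x i ∈ Set.Ioo (0:ℝ) 1) → ((∏ i : Fin k, x i ^ a i) * ∏ i : Fin k, ∏ j : Fin k, if i ≤ j then (1 - (∏ l : Fin k, if i ≤ l ∧ l ≤ j then x l else 1)) ^ (e i j + if i = j then (ν i : ℤ) else 0) else 1) = (∏ i : Fin k, (1 - x i) ^ ν i) * ((∏ i : Fin k, x i ^ a i) * ∏ i : Fin k, ∏ j : Fin k, if i ≤ j then (1 - (∏ l : Fin k, if i ≤ l ∧ l ≤ j then x l else 1)) ^ e i j else 1) 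:=
  fun _ a e ν _ hx => atomFun_add_diag a e ν hx

end Summit.KontsevichZagierPeriods.DihedralNormalForm.TorusDescent.AtomReduction
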